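import Mathlib
import Summits.NavierStokesRegularity.NavierStokesRegularity.Theorems.ThreadingFluxAzimuthalCartanConicalSteadyNS
import Summits.NavierStokesRegularity.NavierStokesRegularity.Theorems.LandauTailHomSteadyProfileExistsProfile
import HarnessLib

/-!
# Crux `PoloidalLiouville` (stmt-NavierStokesRegularity-1222, wall W1), crux idea «azimuthal-cartan-test» (ns-idea-15 g10):
# MÖBIUS DATA = LANDAU — the conical correspondence on the full punctured space

Support file (`--supports stmt-NavierStokesRegularity-1222`, helper; cell `ns-wall-extremal`, width hand ns-wall-eng-6 g6, 0 kit).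

`ThreadingFluxAzimuthalCartanConicalCorrespondence.lean` / `…ConicalSteadyNS.lean` (ns-wall-eng-6 g5) prove ŠVERÁK'S CORRESPONDENCE in the
constructive direction: Liouville data `LiouvilleCone U Φ g H` (`U` open, `0 ∉ U`, `Φ` real-analytic and homogeneous of degree `0` on `U`,
`|x|² ΔΦ + 2e^{Φ} − 2 = 0`) produce the real-analytic steady Navier–Stokes flow `conicalField Φ = ∇Φ + ((2e^{Φ} − 2)/|x|²) x`,
`conicalPressure Φ`, unthreaded and `(−1)`-homogeneous about the vertex (`LiouvilleCone.correspondence`).  Its docstring records, without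
proof, that «the Landau solutions are the case `e^{Φ} = (c² − 1)|x|²/(c|x| − ⟪a, x⟫)²` (Möbius data)» (Šverák, arXiv:math/0604550 §4:
`f = az` gives (4.7)).  THIS FILE proves that sentence in the kernel, for every unit axis `a` and every parameter `c > 1`:

* `LandauCone.potential a c x = log ((c² − 1)|x|²/(c|x| − ⟪a, x⟫)²)` — the Möbius conformal factor pulled back to `ℝ³ ∖ {0}` — with the
  explicit gradient `LandauCone.grad a c x = (2/D) a − (2⟪a, x⟫/(|x|² D)) x` (`D = c|x| − ⟪a, x⟫`) and Jacobian `LandauCone.hess`;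
* ★ `LandauCone.liouvilleCone : LiouvilleCone {x | x ≠ 0} (potential a c) (grad a c) (hess a c)` — LIOUVILLE'S EQUATION FOR THE MÖBIUS
  FACTOR ON ALL OF `ℝ³ ∖ {0}` (Euler `⟪x, ∇Φ⟫ = 0`; `tr ∇²Φ = −(2e^{Φ} − 2)/|x|²` from the first-order structure `∇Φ = β a + k x`,
  `β = 2/D`, `k = −2⟪a, x⟫/(|x|² D)`: `tr ∇²Φ = ∂ₐβ + (Dk(x)x + 3k) = −P/2 − 2k + 3k`, with the tree's `∂ₐβ = −P/2`
  (`LandauTail.fderiv_landauBeta_axis`, `P` = `landauAxisPressure`) and Euler's relation for the `(−2)`-homogeneous `k`);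
* ★★ `LandauCone.conicalField_eq_landauAxisField : conicalField (potential a c) x = landauAxisField a c x` and
  ★ `LandauCone.conicalPressure_eq_landauAxisPressure : conicalPressure (potential a c) x = landauAxisPressure a c x` (`x ≠ 0`) — the
  Literature family `Literature.Analysis.FluidPDE.landauAxisField` / `landauAxisPressure` (Šverák 2011 (4.7), `SverakLandauClassification.lean`)
  IS the conical flow of the Möbius data, exactly, with the normalisations of both files;
* corollaries BY `LiouvilleCone.correspondence`: `LandauCone.isSteadyNSOn_landauAxisField` etc. — Landau's solution is a real-analytic
  classical steady Navier–Stokes flow on `ℝ³ ∖ {0}`, unthreaded and `(−1)`-homogeneous about its vertex, with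
  `curl U = (2e^{Φ}/|x|²)(∇Φ × x)` — an independent kernel route to Landau's theorem (the tree's `LandauTail.landauAxisField_momentum`
  is the direct computation), through the transfer lemma `isSteadyNSOn_congr` (the steady system only sees the flow on the open set).

So the correspondence is NON-VACUOUS on the whole punctured space, and there its image is (at least) the Landau family; the sequel
`…ConicalShellLandau.lean` shows it is EXACTLY the Landau family as soon as the domain contains a full shell about the vertex (Šverák's
theorem read back through the correspondence), which is why the non-axisymmetric K♯ witness (`…ConicalWitness*`, p719807) is cone-local.

HONEST FRAME: explicit steady vector calculus strictly below W1; consistency / placement information for one idea card; closes no crux;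
`PoloidalLiouville` (1222), `SteadyShellRigidity` off the homogeneous stratum and NS regularity are OPEN / NOT proved.

## References
* V. Šverák, On Landau's solutions of the Navier–Stokes equations, J. Math. Sci. 179 (2011) 208–228, arXiv:math/0604550, §4 (4.7). [Sverak2011]
* L. D. Landau, A new exact solution of the Navier–Stokes equations, Dokl. Akad. Nauk SSSR 43 (1944) 286–288.
-/

-- the summit and its single sub-problem share the name (CONVENTIONS §1)
set_option linter.dupNamespace false

noncomputable section

namespace Summit.NavierStokesRegularity.NavierStokesRegularity.Theorems.PoloidalLiouville.AzimuthalCartan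

open Set Function Filter Topology Metric
open scoped ContDiff RealInnerProductSpace
open Literature.Analysis.FluidPDE
open Summit.NavierStokesRegularity.NavierStokesRegularity.Theorems.PoloidalLiouville.CentreJet (E3 IsSteadyNSOn)
open Summit.NavierStokesRegularity.NavierStokesRegularity.Cruxes.ScarEnvelopeTypeI.ForcedTsai (gradient_eq_of_hasFDerivAt_innerSL)
open Summit.NavierStokesRegularity.NavierStokesRegularity.Theorems.PoloidalLiouville.AzimuthalCartan.HalfSpace (hasFDerivAt_div)
open Summit.NavierStokesRegularity.NavierStokesRegularity.Theorems.LandauTail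
  (contDiff_inner_right contDiffAt_landauDen hasFDerivAt_landauDen contDiffAt_landauBeta hasFDerivAt_landauBeta fderiv_landauBeta_axis)

/-! ### A transfer lemma: the steady system only sees the flow on the open set -/

/-- `IsSteadyNSOn U` is invariant under changing `V`, `p` off the OPEN set `U` (all its clauses are local: `ContDiffOn`, and `div`,
`DV`, `∇p`, `ΔV` at points of `U`). -/
theorem isSteadyNSOn_congr {U : Set E3} {V V' : E3 → E3} {p p' : E3 → ℝ} (hU : IsOpen U) (hV : EqOn V V' U) (hp : EqOn p p' U)
    (h : IsSteadyNSOn U V p) : IsSteadyNSOn U V' p' := by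
  obtain ⟨hV3, hp1, hdiv, hmom⟩ := h
  have hVe : ∀ x ∈ U, V' =ᶠ[𝓝 x] V := fun x hx => by
    filter_upwards [hU.mem_nhds hx] with y hy using (hV hy).symm
  have hpe : ∀ x ∈ U, p' =ᶠ[𝓝 x] p := fun x hx => by
    filter_upwards [hU.mem_nhds hx] with y hy using (hp hy).symm
  refine ⟨hV3.congr fun y hy => (hV hy).symm, hp1.congr fun y hy => (hp hy).symm, fun x hx => ?_, fun x hx => ?_⟩
  · rw [VectorCalculus.divergence, (hVe x hx).fderiv_eq]
    exact hdiv x hx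
  · rw [(hVe x hx).fderiv_eq, (hpe x hx).gradient_eq, (InnerProductSpace.laplacian_congr_nhds (hVe x hx)).eq_of_nhds, ← hV hx]
    exact hmom x hx

namespace LandauCone

variable {a : E3} {c : ℝ} {x : E3}

/-! ### The objects -/

/-- THE MÖBIUS POTENTIAL: `Φ(x) = log ((c² − 1)|x|²/(c|x| − ⟪a, x⟫)²)`, i.e. `e^{Φ} = (c² − 1)/(c − cos θ)²` on the unit sphere
(`cos θ = ⟪a, x/|x|⟫`) — the conformal factor of the Möbius map `z ↦ λz` (Šverák §4, `f = az`).  Junk where the argument is `≤ 0`. -/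
def potential (a : E3) (c : ℝ) (x : E3) : ℝ := Real.log ((c ^ 2 - 1) * ‖x‖ ^ 2 / (c * ‖x‖ - ⟪a, x⟫) ^ 2)

/-- The radial coefficient `k = −2⟪a, x⟫/(|x|² (c|x| − ⟪a, x⟫))` of `∇Φ` (homogeneous of degree `−2`). -/
def radialK (a : E3) (c : ℝ) (x : E3) : ℝ := -(2 * ⟪a, x⟫ / (‖x‖ ^ 2 * (c * ‖x‖ - ⟪a, x⟫)))

/-- THE GRADIENT `∇Φ = (2/(c|x| − ⟪a, x⟫)) a + k x`. -/
def grad (a : E3) (c : ℝ) (x : E3) : E3 := (2 / (c * ‖x‖ - ⟪a, x⟫)) • a + radialK a c x • x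

/-- THE HESSIAN `∇²Φ = a ⊗ Dβ + k·Id + x ⊗ Dk` (`β = 2/(c|x| − ⟪a, x⟫)`), as a continuous linear map. -/
def hess (a : E3) (c : ℝ) (x : E3) : E3 →L[ℝ] E3 :=
  (fderiv ℝ (fun y : E3 => 2 / (c * ‖y‖ - ⟪a, y⟫)) x).smulRight a +
    (radialK a c x • ContinuousLinearMap.id ℝ E3 + (fderiv ℝ (radialK a c) x).smulRight x)

/-! ### Positivity and the value of `e^{Φ}` -/

/-- `1 < c ⇒ 1 < |c|` (the form the tree's Landau lemmas take). -/
theorem one_lt_abs (hc : 1 < c) : 1 < |c| := lt_of_lt_of_le hc (le_abs_self c)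

/-- The denominator is positive: `c|x| − ⟪a, x⟫ ≥ (c − 1)|x| > 0` for `‖a‖ = 1`, `1 < c`, `x ≠ 0`. -/
theorem den_pos (ha : ‖a‖ = 1) (hc : 1 < c) (hx : x ≠ 0) : 0 < c * ‖x‖ - ⟪a, x⟫ := by
  have hr : 0 < ‖x‖ := norm_pos_iff.mpr hx
  have hs : ⟪a, x⟫ ≤ ‖x‖ := by simpa [ha] using real_inner_le_norm a x
  nlinarith

/-- The denominator does not vanish. -/
theorem den_ne_zero (ha : ‖a‖ = 1) (hc : 1 < c) (hx : x ≠ 0) : c * ‖x‖ - ⟪a, x⟫ ≠ 0 := (den_pos ha hc hx).ne'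

/-- The argument of the logarithm is positive. -/
theorem arg_pos (ha : ‖a‖ = 1) (hc : 1 < c) (hx : x ≠ 0) : 0 < (c ^ 2 - 1) * ‖x‖ ^ 2 / (c * ‖x‖ - ⟪a, x⟫) ^ 2 := by
  have hr : 0 < ‖x‖ := norm_pos_iff.mpr hx
  have hD := den_pos ha hc hx
  have hc2 : 0 < c ^ 2 - 1 := by nlinarith
  positivity

/-- ★ `e^{Φ} = (c² − 1)|x|²/(c|x| − ⟪a, x⟫)²` off the vertex. -/
theorem exp_potential (ha : ‖a‖ = 1) (hc : 1 < c) (hx : x ≠ 0) :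
    Real.exp (potential a c x) = (c ^ 2 - 1) * ‖x‖ ^ 2 / (c * ‖x‖ - ⟪a, x⟫) ^ 2 := by
  rw [potential, Real.exp_log (arg_pos ha hc hx)]

/-- `Φ` is homogeneous of degree `0`. -/
theorem potential_smul {t : ℝ} (ht : 0 < t) (x : E3) : potential a c (t • x) = potential a c x := by
  rw [potential, potential, norm_smul, Real.norm_of_nonneg ht.le, inner_smul_right]
  rcases eq_or_ne x 0 with rfl | hx
  · simp
  have hr : ‖x‖ ≠ 0 := norm_ne_zero_iff.mpr hx
  congr 1
  have h1 : c * (t * ‖x‖) - t * ⟪a, x⟫ = t * (c * ‖x‖ - ⟪a, x⟫) := by ring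
  rw [h1, mul_pow, mul_pow]
  rcases eq_or_ne (c * ‖x‖ - ⟪a, x⟫) 0 with hD | hD
  · simp [hD]
  · field_simp

/-- ★ The radial coefficient of the correspondence is Landau's: `(2e^{Φ} − 2)/|x|² = 2((c² − 1)|x|²/D² − 1)/|x|²`. -/
theorem radialCoeff_potential (ha : ‖a‖ = 1) (hc : 1 < c) (hx : x ≠ 0) :
    radialCoeff (potential a c) x = 2 * ((c ^ 2 - 1) * ‖x‖ ^ 2 / (c * ‖x‖ - ⟪a, x⟫) ^ 2 - 1) / ‖x‖ ^ 2 := by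
  rw [radialCoeff, exp_potential ha hc hx]
  ring

/-! ### First derivatives -/

/-- ★ `DΦ = ⟪∇Φ, ·⟫` with the explicit gradient `grad`, at every `x ≠ 0`. -/
theorem hasFDerivAt_potential (ha : ‖a‖ = 1) (hc : 1 < c) (hx : x ≠ 0) :
    HasFDerivAt (potential a c) (innerSL ℝ (grad a c x)) x := by
  have hr : ‖x‖ ≠ 0 := norm_ne_zero_iff.mpr hx
  have hD := den_ne_zero ha hc hx
  have hN : HasFDerivAt (fun y : E3 => (c ^ 2 - 1) * ‖y‖ ^ 2) ((c ^ 2 - 1) • ((2 : ℕ) • innerSL ℝ x)) x :=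
    ((hasStrictFDerivAt_norm_sq x).hasFDerivAt).const_mul (c ^ 2 - 1)
  have hD1 : HasFDerivAt (fun y : E3 => c * ‖y‖ - ⟪a, y⟫) (innerSL ℝ ((c * ‖x‖⁻¹) • x - a)) x :=
    hasFDerivAt_landauDen c a hx
  have hD2 := hD1.pow 2
  have hF := hasFDerivAt_div hN hD2 (pow_ne_zero 2 hD)
  have hL := hF.log (arg_pos ha hc hx).ne'
  unfold potential
  refine hL.congr_fderiv ?_
  ext v
  simp only [grad, radialK, smul_apply, sub_apply, innerSL_apply_apply, smul_eq_mul, nsmul_eq_mul, inner_add_left, inner_smul_left,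
    inner_sub_left, conj_trivial, Nat.cast_ofNat, pow_one, Nat.add_one_sub_one]
  have hc2 : c ^ 2 - 1 ≠ 0 := by nlinarith
  field_simp
  ring

/-- ★ `∇Φ = grad` off the vertex. -/
theorem gradient_potential (ha : ‖a‖ = 1) (hc : 1 < c) (hx : x ≠ 0) : gradient (potential a c) x = grad a c x :=
  gradient_eq_of_hasFDerivAt_innerSL (hasFDerivAt_potential ha hc hx)

/-- `k` is smooth off the vertex. -/
theorem contDiffAt_radialK (ha : ‖a‖ = 1) (hc : 1 < c) (hx : x ≠ 0) {n : WithTop ℕ∞} : ContDiffAt ℝ n (radialK a c) x := by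
  have hr : ‖x‖ ≠ 0 := norm_ne_zero_iff.mpr hx
  have hinner : ContDiffAt ℝ n (fun y : E3 => ⟪a, y⟫) x := (contDiff_inner_right a).contDiffAt
  have hnsq : ContDiffAt ℝ n (fun y : E3 => ‖y‖ ^ 2) x := (contDiffAt_norm ℝ hx).pow 2
  unfold radialK
  exact ((contDiffAt_const.mul hinner).div (hnsq.mul (contDiffAt_landauDen c a hx))
    (mul_ne_zero (pow_ne_zero 2 hr) (den_ne_zero ha hc hx))).neg

/-- `k` is differentiable off the vertex. -/
theorem differentiableAt_radialK (ha : ‖a‖ = 1) (hc : 1 < c) (hx : x ≠ 0) : DifferentiableAt ℝ (radialK a c) x :=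
  (contDiffAt_radialK ha hc hx (n := 1)).differentiableAt one_ne_zero

/-- `∇Φ` is smooth off the vertex. -/
theorem contDiffAt_grad (ha : ‖a‖ = 1) (hc : 1 < c) (hx : x ≠ 0) {n : WithTop ℕ∞} : ContDiffAt ℝ n (grad a c) x := by
  unfold grad
  exact ((contDiffAt_landauBeta ha (one_lt_abs hc) hx).smul contDiffAt_const).add ((contDiffAt_radialK ha hc hx).smul contDiffAt_id)

/-- ★ `D(∇Φ) = hess` off the vertex (product rules; `hess` is built from the derivatives of `β` and `k`). -/
theorem hasFDerivAt_grad (ha : ‖a‖ = 1) (hc : 1 < c) (hx : x ≠ 0) : HasFDerivAt (grad a c) (hess a c x) x := by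
  have hβ : HasFDerivAt (fun y : E3 => 2 / (c * ‖y‖ - ⟪a, y⟫)) (fderiv ℝ (fun y : E3 => 2 / (c * ‖y‖ - ⟪a, y⟫)) x) x :=
    (hasFDerivAt_landauBeta ha (one_lt_abs hc) hx).differentiableAt.hasFDerivAt
  have hk : HasFDerivAt (radialK a c) (fderiv ℝ (radialK a c) x) x := (differentiableAt_radialK ha hc hx).hasFDerivAt
  unfold grad hess
  exact (hβ.smul_const a).add (hk.smul (hasFDerivAt_id x))

/-- `k` is homogeneous of degree `−2`. -/
theorem radialK_smul {t : ℝ} (ht : 0 < t) (x : E3) : radialK a c (t • x) = (t ^ 2)⁻¹ * radialK a c x := by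
  rw [radialK, radialK, norm_smul, Real.norm_of_nonneg ht.le, inner_smul_right]
  have ht0 : t ≠ 0 := ht.ne'
  have h1 : c * (t * ‖x‖) - t * ⟪a, x⟫ = t * (c * ‖x‖ - ⟪a, x⟫) := by ring
  rw [h1]
  rcases eq_or_ne ‖x‖ 0 with hr | hr
  · simp [hr]
  rcases eq_or_ne (c * ‖x‖ - ⟪a, x⟫) 0 with hD | hD
  · simp [hD]
  field_simp

/-- **Euler's relation for `k`**: `Dk(x) x = −2 k(x)`. -/
theorem fderiv_radialK_self (ha : ‖a‖ = 1) (hc : 1 < c) (hx : x ≠ 0) : fderiv ℝ (radialK a c) x x = -2 * radialK a c x := by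
  have h := fderiv_apply_self_of_smul_eq_rpow_smul (Φ := radialK a c) (x := x) (m := -2)
    (fun t ht => by
      rw [Real.rpow_neg ht.le, Real.rpow_two, smul_eq_mul]
      exact radialK_smul ht x)
    (differentiableAt_radialK ha hc hx)
  rw [h, smul_eq_mul]

/-! ### Euler and Liouville -/

/-- ★ **EULER**: `⟪x, ∇Φ(x)⟫ = 0` (`Φ` is homogeneous of degree `0`). -/
theorem inner_self_grad (ha : ‖a‖ = 1) (hc : 1 < c) (hx : x ≠ 0) : ⟪x, grad a c x⟫ = 0 := by
  have hr : ‖x‖ ≠ 0 := norm_ne_zero_iff.mpr hx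
  have hD := den_ne_zero ha hc hx
  rw [grad, radialK, inner_add_right, inner_smul_right, inner_smul_right, real_inner_self_eq_norm_sq, real_inner_comm x a]
  field_simp
  ring

/-- The trace of the Hessian from its first-order structure: `tr ∇²Φ = ∂ₐβ + 3k + Dk(x)x`. -/
theorem trace_hess (x : E3) :
    ∑ i, hess a c x (EuclideanSpace.single i 1) i =
      fderiv ℝ (fun y : E3 => 2 / (c * ‖y‖ - ⟪a, y⟫)) x a + 3 * radialK a c x + fderiv ℝ (radialK a c) x x := by
  have h1 : ∀ i : Fin 3, hess a c x (EuclideanSpace.single i 1) i =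
      fderiv ℝ (fun y : E3 => 2 / (c * ‖y‖ - ⟪a, y⟫)) x (EuclideanSpace.single i 1) * a i + radialK a c x +
        fderiv ℝ (radialK a c) x (EuclideanSpace.single i 1) * x i := fun i => by
    simp [hess]
    ring
  simp only [h1, Finset.sum_add_distrib, sum_apply_single_mul, Finset.sum_const, Finset.card_univ, Fintype.card_fin, nsmul_eq_mul]
  push_cast
  ring

/-- ★ **`tr ∇²Φ = −(2e^{Φ} − 2)/|x|²`** — Liouville's equation, via `∂ₐβ = −P/2` (tree) and Euler's relation for `k`. -/
theorem trace_hess_eq (ha : ‖a‖ = 1) (hc : 1 < c) (hx : x ≠ 0) :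
    ∑ i, hess a c x (EuclideanSpace.single i 1) i = -radialCoeff (potential a c) x := by
  have hr : ‖x‖ ≠ 0 := norm_ne_zero_iff.mpr hx
  have hD := den_ne_zero ha hc hx
  rw [trace_hess, fderiv_landauBeta_axis ha (one_lt_abs hc) hx, fderiv_radialK_self ha hc hx, radialCoeff_potential ha hc hx,
    landauAxisPressure, radialK]
  field_simp
  ring

/-- ★ **LIOUVILLE'S EQUATION in `ℝ³` form** for the Möbius factor: `|x|² tr ∇²Φ + 2e^{Φ} − 2 = 0` on `ℝ³ ∖ {0}`. -/
theorem liouville_identity (ha : ‖a‖ = 1) (hc : 1 < c) (hx : x ≠ 0) :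
    ‖x‖ ^ 2 * (∑ i, hess a c x (EuclideanSpace.single i 1) i) + 2 * Real.exp (potential a c x) - 2 = 0 := by
  have hr : ‖x‖ ≠ 0 := norm_ne_zero_iff.mpr hx
  rw [trace_hess_eq ha hc hx, radialCoeff]
  field_simp
  ring

/-! ### Analyticity and the Liouville data -/

/-- `Φ` is real-analytic off the vertex. -/
theorem analyticAt_potential (ha : ‖a‖ = 1) (hc : 1 < c) (hx : x ≠ 0) : AnalyticAt ℝ (potential a c) x := by
  have hr : ‖x‖ ≠ 0 := norm_ne_zero_iff.mpr hx
  have harg : ContDiffAt ℝ ω (fun y : E3 => (c ^ 2 - 1) * ‖y‖ ^ 2 / (c * ‖y‖ - ⟪a, y⟫) ^ 2) x :=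
    (contDiffAt_const.mul ((contDiffAt_norm ℝ hx).pow 2)).div ((contDiffAt_landauDen c a hx).pow 2)
      (pow_ne_zero 2 (den_ne_zero ha hc hx))
  rw [show potential a c = Real.log ∘ (fun y : E3 => (c ^ 2 - 1) * ‖y‖ ^ 2 / (c * ‖y‖ - ⟪a, y⟫) ^ 2) from rfl]
  exact AnalyticAt.comp (g := Real.log) (f := fun y : E3 => (c ^ 2 - 1) * ‖y‖ ^ 2 / (c * ‖y‖ - ⟪a, y⟫) ^ 2)
    (analyticAt_log (arg_pos ha hc hx)) harg.analyticAt

/-- ★★ **THE MÖBIUS DATA ARE LIOUVILLE DATA ON THE WHOLE PUNCTURED SPACE** (the hypotheses of the conical correspondence, with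
`U = ℝ³ ∖ {0}`). -/
theorem liouvilleCone (ha : ‖a‖ = 1) (hc : 1 < c) : LiouvilleCone {x : E3 | x ≠ 0} (potential a c) (grad a c) (hess a c) where
  isOpen := isOpen_ne
  ne_zero := fun _ hy => hy
  analyticOnNhd := fun _ hy => analyticAt_potential ha hc hy
  hasFDerivAt_potential := fun _ hy => hasFDerivAt_potential ha hc hy
  hasFDerivAt_gradient := fun _ hy => hasFDerivAt_grad ha hc hy
  euler := fun _ hy => inner_self_grad ha hc hy
  liouville := fun _ hy => liouville_identity ha hc hy

/-- The data restricted to any open `U ∌ 0` (cones, shells, balls off the vertex). -/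
theorem liouvilleCone_of_subset (ha : ‖a‖ = 1) (hc : 1 < c) {U : Set E3} (hU : IsOpen U) (h0 : ∀ x ∈ U, x ≠ 0) :
    LiouvilleCone U (potential a c) (grad a c) (hess a c) where
  isOpen := hU
  ne_zero := h0
  analyticOnNhd := fun _ hy => analyticAt_potential ha hc (h0 _ hy)
  hasFDerivAt_potential := fun _ hy => hasFDerivAt_potential ha hc (h0 _ hy)
  hasFDerivAt_gradient := fun _ hy => hasFDerivAt_grad ha hc (h0 _ hy)
  euler := fun _ hy => inner_self_grad ha hc (h0 _ hy)
  liouville := fun _ hy => liouville_identity ha hc (h0 _ hy)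

/-! ### Möbius data = Landau -/

/-- ★★★ **THE CONICAL FLOW OF THE MÖBIUS DATA IS LANDAU'S SOLUTION**: `conicalField Φ = landauAxisField a c` off the vertex
(`∇Φ + ((2e^{Φ} − 2)/|x|²) x` against Šverák's (4.7) as typed in `SverakLandauClassification.lean`). -/
theorem conicalField_eq_landauAxisField (ha : ‖a‖ = 1) (hc : 1 < c) (hx : x ≠ 0) :
    conicalField (potential a c) x = landauAxisField a c x := by
  have hr : ‖x‖ ≠ 0 := norm_ne_zero_iff.mpr hx
  have hD := den_ne_zero ha hc hx
  rw [conicalField, gradient_potential ha hc hx, radialCoeff_potential ha hc hx, landauAxisField, grad, radialK]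
  ext i
  simp only [PiLp.add_apply, PiLp.smul_apply, PiLp.sub_apply, smul_eq_mul]
  field_simp
  ring

/-- ★ **… AND ITS PRESSURE IS LANDAU'S PRESSURE**: `(2e^{Φ} − 2)/|x|² − ½|∇Φ|² = landauAxisPressure a c` off the vertex. -/
theorem conicalPressure_eq_landauAxisPressure (ha : ‖a‖ = 1) (hc : 1 < c) (hx : x ≠ 0) :
    conicalPressure (potential a c) x = landauAxisPressure a c x := by
  have hr : ‖x‖ ≠ 0 := norm_ne_zero_iff.mpr hx
  have hD := den_ne_zero ha hc hx
  have hsq : ‖grad a c x‖ ^ 2 = (2 / (c * ‖x‖ - ⟪a, x⟫)) ^ 2 + 2 * (2 / (c * ‖x‖ - ⟪a, x⟫)) * radialK a c x * ⟪a, x⟫ +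
      radialK a c x ^ 2 * ‖x‖ ^ 2 := by
    rw [← real_inner_self_eq_norm_sq, grad]
    simp only [inner_add_left, inner_add_right, inner_smul_left, inner_smul_right, conj_trivial, real_inner_self_eq_norm_sq, ha,
      real_inner_comm x a]
    ring
  rw [conicalPressure, gradient_potential ha hc hx, radialCoeff_potential ha hc hx, hsq, landauAxisPressure, radialK]
  field_simp
  ring

/-- The two flows agree on the punctured space (as an `EqOn`, for the transfer lemma). -/
theorem eqOn_conicalField (ha : ‖a‖ = 1) (hc : 1 < c) : EqOn (conicalField (potential a c)) (landauAxisField a c) {x : E3 | x ≠ 0} :=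
  fun _ hy => conicalField_eq_landauAxisField ha hc hy

/-- The two pressures agree on the punctured space. -/
theorem eqOn_conicalPressure (ha : ‖a‖ = 1) (hc : 1 < c) :
    EqOn (conicalPressure (potential a c)) (landauAxisPressure a c) {x : E3 | x ≠ 0} :=
  fun _ hy => conicalPressure_eq_landauAxisPressure ha hc hy

/-! ### Corollaries by the correspondence: Landau's theorem, unthreadedness, homogeneity, vorticity -/

/-- ★ **LANDAU'S THEOREM through the correspondence**: `landauAxisField a c`, `landauAxisPressure a c` form a classical steady
Navier–Stokes flow on `ℝ³ ∖ {0}` (`IsSteadyNSOn`: `div U = 0`, `DU·U + ∇P = ΔU`). -/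
theorem isSteadyNSOn_landauAxisField (ha : ‖a‖ = 1) (hc : 1 < c) :
    IsSteadyNSOn {x : E3 | x ≠ 0} (landauAxisField a c) (landauAxisPressure a c) :=
  isSteadyNSOn_congr isOpen_ne (eqOn_conicalField ha hc) (eqOn_conicalPressure ha hc) (liouvilleCone ha hc).isSteadyNSOn

/-- Landau's solution is real-analytic on `ℝ³ ∖ {0}` (through the correspondence). -/
theorem analyticOnNhd_landauAxisField (ha : ‖a‖ = 1) (hc : 1 < c) : AnalyticOnNhd ℝ (landauAxisField a c) {x : E3 | x ≠ 0} :=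
  fun x hx => ((liouvilleCone ha hc).analyticAt_conicalField hx).congr (by
    filter_upwards [isOpen_ne.mem_nhds hx] with y hy using conicalField_eq_landauAxisField ha hc hy)

/-- ★ Landau's solution is UNTHREADED about its vertex: `⟪x, curl U x⟫ = 0` on `ℝ³ ∖ {0}` (vortex lines on the spheres). -/
theorem isUnthreadedOn_landauAxisField (ha : ‖a‖ = 1) (hc : 1 < c) : IsUnthreadedOn {x : E3 | x ≠ 0} 0 (landauAxisField a c) := by
  intro x hx
  have hev : landauAxisField a c =ᶠ[𝓝 x] conicalField (potential a c) := by
    filter_upwards [isOpen_ne.mem_nhds hx] with y hy using (conicalField_eq_landauAxisField ha hc hy).symm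
  rw [curl_eq_curlCLM, hev.fderiv_eq, ← curl_eq_curlCLM]
  exact (liouvilleCone ha hc).isUnthreadedOn x hx

/-- ★ Landau's solution is homogeneous of degree `−1` about its vertex in the card's differential sense: `DU(x) x = −U x`. -/
theorem isMinusOneHomogeneousOn_landauAxisField (ha : ‖a‖ = 1) (hc : 1 < c) :
    IsMinusOneHomogeneousOn {x : E3 | x ≠ 0} 0 (landauAxisField a c) := by
  intro x hx
  have hev : landauAxisField a c =ᶠ[𝓝 x] conicalField (potential a c) := by
    filter_upwards [isOpen_ne.mem_nhds hx] with y hy using (conicalField_eq_landauAxisField ha hc hy).symm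
  rw [hev.fderiv_eq, ← conicalField_eq_landauAxisField ha hc hx]
  exact (liouvilleCone ha hc).isMinusOneHomogeneousOn x hx

/-- `(β a + k x) × x = β (a × x)`. -/
theorem cross_grad_self (x : E3) : cross (grad a c x) x = (2 / (c * ‖x‖ - ⟪a, x⟫)) • cross a x := by
  ext i
  fin_cases i <;> simp [grad, cross, cross_apply]

/-- ★ The vorticity of Landau's solution through the correspondence: `curl U = (2e^{Φ}/|x|²)(∇Φ × x)
= (2(c² − 1)/(c|x| − ⟪a, x⟫)²)·(2/(c|x| − ⟪a, x⟫))·(a × x)` — a multiple of `a × x` (azimuthal, as it must be). -/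
theorem curl_landauAxisField (ha : ‖a‖ = 1) (hc : 1 < c) (hx : x ≠ 0) :
    curl (landauAxisField a c) x = (2 * ((c ^ 2 - 1) * ‖x‖ ^ 2 / (c * ‖x‖ - ⟪a, x⟫) ^ 2) / ‖x‖ ^ 2 * (2 / (c * ‖x‖ - ⟪a, x⟫))) •
      cross a x := by
  have hev : landauAxisField a c =ᶠ[𝓝 x] conicalField (potential a c) := by
    filter_upwards [isOpen_ne.mem_nhds hx] with y hy using (conicalField_eq_landauAxisField ha hc hy).symm
  rw [curl_eq_curlCLM, hev.fderiv_eq, ← curl_eq_curlCLM, (liouvilleCone ha hc).curl_conicalField hx, exp_potential ha hc hx,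
    cross_grad_self, smul_smul]

end LandauCone

end Summit.NavierStokesRegularity.NavierStokesRegularity.Theorems.PoloidalLiouville.AzimuthalCartan

end
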